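/-
Copyright (c) 2026 the pub-hodgecm-mathlib formalisation cell (harness21).  Prover seat hodgecm-mathlib-LH4-p13 (g5), Track A «(D-RAM) FOUR-FRAME», unit U2H, (ρ2b′-X)
organ O-Sign ∕ seam S6b «REALIZABILITY» (payer LH4-p14 (g4) MAP v1∕v2), 2026-09-04.
-/
import Literature.NumberTheory.LocalFields.WildQuadraticDatumTraceBound   -- ★ `v_add_map_le_pow_pred_mul` (Tr 𝔭^j ⊆ 𝔭^{j+d−1}); brings ★ `WildQuadraticDatumTrace` (parities of `d`, `t`; `Tr ϖ`), ★ `WildQuadraticEisensteinFrame` (coordinates `a + bϖ`)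
import HarnessLib

/-!
# The DEPTH OF THE NORM on the higher units of a ramified quadratic datum: `v(N(1 + e) − 1) ≥ v(e) + d − 1`, with EQUALITY when `v(e) ≢ d (mod 2)`
# (Serre, *Local Fields* V §3 Prop. 5: `N(U_E^{(ψ(n))}) = U_F^{(n)}`, `ψ(n) = 2n − (d − 1)` above the break `d − 1`)

Topic `NumberTheory/LocalFields`; namespace `Literature.NumberTheory.LocalFields.WildQuadraticDatum` (the one-field datum ★ `IsRamifiedQuadraticDatum σ ϖ d t`: `σ` an isometric
involution of the valued field `K`, `σ`-fixed elements of even valuation, `|ϖ| = exp(−1)`, `|ϖ − σϖ| = |ϖ|^d`, `|2| = |ϖ|^t`).  THEOREMS ONLY (no definition, no instance, no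
notation, no named fact, no `sorry`); CM-free; kernel lane `--supports stmt-HodgeConjecture-24833` (count-neutral).  Cell `pub/hodgecm-mathlib` (D-0151), crux H413.
WHAT IS PROVED (conjunct currency, then the `IsRamifiedQuadraticDatum` wrappers).  Write `N(1 + e) − 1 = e + σe + e·σe`.
* §1 `v_add_map_add_mul_map_le` — for `|e| ≤ |ϖ|^r` with `d ≤ r + 1`: **`|e + σe + e·σe| ≤ |ϖ|^{r + d − 1}`** (★ trace bound `|e + σe| ≤ |ϖ|^{d−1}|e|` and `2r ≥ r + d − 1`).
* §2 `v_add_map_add_mul_map_eq` — for `|e| = |ϖ|^r` with `d ≤ r` and **`r ≢ d (mod 2)`: `|e + σe + e·σe| = |ϖ|^{r + d − 1}` EXACTLY**: in coordinates `e = a + bϖ` (`σ`-fixed `a, b`,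
  ★ `exists_fixed_coords_of_map_ne`, `|e| = max(|a|, |b||ϖ|)` ★ `v_fixed_add_fixed_mul_eq_max`) the trace is `2a + b·Tr ϖ` (★ `add_map_of_coords`); when `d` is ODD (`= t + 1`,
  ★ `odd_iff_eq_succ`) `r` is even, `|a| = |ϖ|^r` and the term `2a` has the exact valuation `|ϖ|^{t + r} = |ϖ|^{r+d−1}` while `|b·Tr ϖ| ≤ |ϖ|^{r + d + 1}` (★
  `v_trace_varpi_le_succ_of_odd`); when `d` is EVEN (`≤ t`) `r` is odd, `|b| = |ϖ|^{r−1}` and `b·Tr ϖ` has the exact valuation `|ϖ|^{r − 1 + d}` (★ `v_trace_varpi_eq_of_even`) while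
  `|2a| ≤ |ϖ|^{t + r + 1}`; the norm term `e·σe` is `|ϖ|^{2r}`-small.
* §3 the same two statements from `hD : IsRamifiedQuadraticDatum σ ϖ d t`.
USE (crux H413, (ρ2b′-X) seam S6b, LH4-p13): for a deep Θ-unitary `ξ = (1 + e₀)(1 + qα)` of the biquadratic `M = E·K` (type U) one has `m = v(e₀)`, `jl = v(q) = v(N(1+e₀) − 1)`, so
§1–§2 give the REALIZABILITY disjunction `(m ≡ d ∧ m + d ≤ jl) ∨ (m = jl − d + 1)` of ★ `F0P3cDyRamToricCensusSumUnr.toricCensusSum_unr` (`hreal`).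
HONEST LABEL: HC_CM is proved only modulo the 7 printed citations (2 remaining named inputs: hLiu418 = stmt-HodgeConjecture-24832, h413 = stmt-HodgeConjecture-24833) until rung 0
closes; count-neutral, Mathlib-footed.

## References
* [Serre1979] J.-P. Serre, *Local Fields*, GTM 67 (1979), Ch. III §3 Prop. 7, §6 Prop. 13; Ch. V §3 Prop. 5 and Cor. 2–3 pp. 85–87.
* [Omeara1963] O. T. O'Meara, *Introduction to Quadratic Forms*, Grundlehren 117 (1963), §63A (63:2–63:5, the quadratic defect).
-/

set_option autoImplicit false

noncomputable section

open WithZero Literature.NumberTheory.Automorphic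

namespace Literature.NumberTheory.LocalFields.WildQuadraticDatum

/-! ## §1 The inequality -/

section Conjuncts

variable {K : Type*} [Field K] [Valued K ℤᵐ⁰] {σ : K →+* K} {ϖ : K} {d t : ℕ}

/-- **`|N(1 + e) − 1| ≤ |ϖ|^{r + d − 1}` for `|e| ≤ |ϖ|^r`, `d ≤ r + 1`** (`N(1+e) − 1 = e + σe + e·σe`): the trace part by ★ `v_add_map_le_pow_pred_mul`
(`Tr 𝔭_E^r ⊆ 𝔭^{r+d−1}`), the norm part since `2r ≥ r + d − 1`. [cite: Serre1979, Ch. V §3 Prop. 5; Ch. III §3 Prop. 7] -/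
theorem v_add_map_add_mul_map_le (hσ : ∀ x, σ (σ x) = x) (hvσ : ∀ a, Valued.v (σ a) = Valued.v a)
    (hfix : ∀ x : K, σ x = x → x ≠ 0 → ∃ n : ℤ, Valued.v x = exp (2 * n))
    (hϖ : Valued.v ϖ = exp (-1 : ℤ)) (hd : Valued.v (ϖ - σ ϖ) = Valued.v ϖ ^ d) (ht : Valued.v (2 : K) = Valued.v ϖ ^ t) (h1d : 1 ≤ d)
    {e : K} {r : ℕ} (hr : d ≤ r + 1) (he : Valued.v e ≤ Valued.v ϖ ^ r) :
    Valued.v (e + σ e + e * σ e) ≤ Valued.v ϖ ^ (r + d - 1) := by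
  have htr : Valued.v (e + σ e) ≤ Valued.v ϖ ^ (r + d - 1) := by
    refine (v_add_map_le_pow_pred_mul hσ hfix hϖ hd ht h1d e).trans ?_
    calc Valued.v ϖ ^ (d - 1) * Valued.v e ≤ Valued.v ϖ ^ (d - 1) * Valued.v ϖ ^ r := by gcongr
      _ = Valued.v ϖ ^ (r + d - 1) := by rw [← pow_add]; congr 1; omega
  have hN : Valued.v (e * σ e) ≤ Valued.v ϖ ^ (r + d - 1) := by
    rw [Valuation.map_mul, hvσ]
    calc Valued.v e * Valued.v e ≤ Valued.v ϖ ^ r * Valued.v ϖ ^ r := by gcongr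
      _ = Valued.v ϖ ^ (2 * r) := by rw [← pow_add, two_mul]
      _ ≤ Valued.v ϖ ^ (r + d - 1) := by
          rw [v_varpi_pow hϖ, v_varpi_pow hϖ, exp_le_exp]; omega
  exact (Valuation.map_add _ _ _).trans (max_le htr hN)

/-! ## §2 The equality off the parity of `d` -/

/-- A `σ`-fixed element is `0` or has valuation `exp(2n)`; if it is `≤ exp(k)` resp. `= exp(k)` the parity of `k` is constrained. [cite: Serre1979, Ch. III §6] -/
private theorem v_fixed_le_exp_of_le_of_odd (hfix : ∀ x : K, σ x = x → x ≠ 0 → ∃ n : ℤ, Valued.v x = exp (2 * n))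
    {a : K} (ha : σ a = a) {k : ℤ} (hk : ¬ Even k) (hle : Valued.v a ≤ exp k) : Valued.v a ≤ exp (k - 1) := by
  rcases eq_or_ne a 0 with rfl | ha0
  · rw [map_zero]; exact zero_le
  obtain ⟨n, hn⟩ := hfix a ha ha0
  rw [hn, exp_le_exp] at hle ⊢
  rcases lt_or_eq_of_le hle with h | h
  · omega
  · exact absurd ⟨n, by omega⟩ hk

/-- **`|N(1 + e) − 1| = |ϖ|^{r + d − 1}` EXACTLY for `|e| = |ϖ|^r`, `d ≤ r`, `r ≢ d (mod 2)`** — the level at which the norm map on the higher units is a bijection on graded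
pieces (Serre V §3 Prop. 5 (iii)): in coordinates `e = a + bϖ` the trace `2a + b·Tr ϖ` has ONE dominant term of valuation exactly `|ϖ|^{r+d−1}` (`2a` when `d = t + 1` is odd and `r`
even; `b·Tr ϖ` when `d ≤ t` is even and `r` odd), and `|e·σe| = |ϖ|^{2r}` is smaller. [cite: Serre1979, Ch. V §3 Prop. 5; Ch. III §6 Prop. 13] [cite: Omeara1963, §63A 63:3–63:5] -/
theorem v_add_map_add_mul_map_eq (hσ : ∀ x, σ (σ x) = x) (hvσ : ∀ a, Valued.v (σ a) = Valued.v a)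
    (hfix : ∀ x : K, σ x = x → x ≠ 0 → ∃ n : ℤ, Valued.v x = exp (2 * n))
    (hϖ : Valued.v ϖ = exp (-1 : ℤ)) (hd : Valued.v (ϖ - σ ϖ) = Valued.v ϖ ^ d) (ht : Valued.v (2 : K) = Valued.v ϖ ^ t) (h1d : 1 ≤ d)
    {e : K} {r : ℕ} (hr : d ≤ r) (he : Valued.v e = Valued.v ϖ ^ r) (hpar : r % 2 ≠ d % 2) :
    Valued.v (e + σ e + e * σ e) = Valued.v ϖ ^ (r + d - 1) := by
  have hfix' := even_log_v_of_fixed hfix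
  obtain ⟨te, hte⟩ := even_t hfix hϖ ht
  have hdt := d_le_succ_t hσ hfix hϖ hd ht
  -- the norm term is small
  have hN : Valued.v (e * σ e) < Valued.v ϖ ^ (r + d - 1) := by
    rw [Valuation.map_mul, hvσ, he, ← pow_add, v_varpi_pow hϖ, v_varpi_pow hϖ, exp_lt_exp]; omega
  -- so it suffices to compute the trace term exactly
  suffices htr : Valued.v (e + σ e) = Valued.v ϖ ^ (r + d - 1) by
    rw [Valuation.map_add_eq_of_lt_left _ (by rw [htr]; exact hN)]
    exact htr
  -- coordinates
  obtain ⟨a, b, ha, hb, rfl⟩ := exists_fixed_coords_of_map_ne hσ (map_varpi_ne hϖ hd) e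
  have hsplit := v_fixed_add_fixed_mul_eq_max hfix' hϖ ha hb
  rw [he, v_varpi_pow hϖ] at hsplit
  rw [add_map_of_coords ha hb, v_varpi_pow hϖ]
  rcases Nat.even_or_odd d with hdev | hdodd
  · -- `d` even, `d ≤ t`, `r` odd: the term `b·Tr ϖ` dominates
    have hrodd : ¬ Even (r : ℤ) := fun h => hpar (by
      obtain ⟨k, hk⟩ := h; obtain ⟨k', hk'⟩ := hdev; omega)
    have hdle : d ≤ t := by
      obtain ⟨k, hk⟩ := hdev
      omega
    have hτ : Valued.v (ϖ + σ ϖ) = Valued.v ϖ ^ d := v_trace_varpi_eq_of_even hσ hfix hϖ hd ht hdev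
    -- `|a| ≤ exp(−r)` hence `≤ exp(−r−1)` (parity), `|b|·exp(−1) = exp(−r)`
    have hva : Valued.v a ≤ exp (-(r : ℤ) - 1) :=
      v_fixed_le_exp_of_le_of_odd hfix ha (by simpa using hrodd) (hsplit ▸ le_max_left _ _)
    have hvb : Valued.v b * exp (-1 : ℤ) = exp (-(r : ℤ)) := by
      have hle : Valued.v b * exp (-1 : ℤ) ≤ exp (-(r : ℤ)) := hsplit ▸ le_max_right _ _
      rcases (max_eq_iff.1 hsplit.symm) with ⟨h, -⟩ | ⟨h, -⟩
      · -- `|a| = exp(−r)` contradicts the parity of `r`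
        exfalso
        rcases eq_or_ne a 0 with rfl | ha0
        · rw [map_zero] at h; exact exp_ne_zero h.symm
        obtain ⟨n, hn⟩ := hfix a ha ha0
        rw [hn, exp_inj] at h
        exact hrodd ⟨-n, by omega⟩
      · exact h
    have hvb' : Valued.v b = exp (-(r : ℤ) + 1) := by
      calc Valued.v b = Valued.v b * exp (-1 : ℤ) * exp (1 : ℤ) := by
            rw [mul_assoc, ← exp_add, show (-1 : ℤ) + 1 = 0 by norm_num, exp_zero, mul_one]
        _ = exp (-(r : ℤ)) * exp (1 : ℤ) := by rw [hvb]
        _ = exp (-(r : ℤ) + 1) := (exp_add _ _).symm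
    have h2a : Valued.v (2 * a) < exp (-((r + d - 1 : ℕ) : ℤ)) := by
      rw [Valuation.map_mul, ht, v_varpi_pow hϖ]
      calc exp (-(t : ℤ)) * Valued.v a ≤ exp (-(t : ℤ)) * exp (-(r : ℤ) - 1) := by gcongr
        _ = exp (-(t : ℤ) + (-(r : ℤ) - 1)) := (exp_add _ _).symm
        _ < exp (-((r + d - 1 : ℕ) : ℤ)) := by rw [exp_lt_exp]; push_cast [Nat.cast_sub (show 1 ≤ r + d by omega)]; omega
    have hbτ : Valued.v (b * (ϖ + σ ϖ)) = exp (-((r + d - 1 : ℕ) : ℤ)) := by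
      rw [Valuation.map_mul, hτ, hvb', v_varpi_pow hϖ, ← exp_add]
      congr 1; push_cast [Nat.cast_sub (show 1 ≤ r + d by omega)]; omega
    rw [Valuation.map_add_eq_of_lt_right _ (by rw [hbτ]; exact h2a), hbτ]
  · -- `d` odd, `d = t + 1`, `r` even: the term `2a` dominates
    have hdt1 : d = t + 1 := (odd_iff_eq_succ hσ hfix hϖ hd ht).1 hdodd
    have hrev : Even (r : ℤ) := by
      rcases Int.even_or_odd r with h | h
      · exact h
      · exfalso; apply hpar; obtain ⟨k, hk⟩ := h; obtain ⟨k', hk'⟩ := hdodd; omega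
    -- `|a| = exp(−r)`, `|b|·exp(−1) ≤ exp(−r)` hence `|b| ≤ exp(−r)` (parity)
    have hva : Valued.v a = exp (-(r : ℤ)) := by
      rcases (max_eq_iff.1 hsplit.symm) with ⟨h, -⟩ | ⟨h, -⟩
      · exact h
      · exfalso
        rcases eq_or_ne b 0 with rfl | hb0
        · rw [map_zero, zero_mul] at h; exact exp_ne_zero h.symm
        obtain ⟨n, hn⟩ := hfix b hb hb0
        rw [hn, ← exp_add, exp_inj] at h
        obtain ⟨k, hk⟩ := hrev; omega
    have hvb : Valued.v b ≤ exp (-(r : ℤ)) := by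
      have hle : Valued.v b * exp (-1 : ℤ) ≤ exp (-(r : ℤ)) := hsplit ▸ le_max_right _ _
      have hle' : Valued.v b ≤ exp (-(r : ℤ) + 1) := by
        calc Valued.v b = Valued.v b * exp (-1 : ℤ) * exp (1 : ℤ) := by
              rw [mul_assoc, ← exp_add, show (-1 : ℤ) + 1 = 0 by norm_num, exp_zero, mul_one]
          _ ≤ exp (-(r : ℤ)) * exp (1 : ℤ) := by gcongr
          _ = exp (-(r : ℤ) + 1) := (exp_add _ _).symm
      have := v_fixed_le_exp_of_le_of_odd hfix hb (k := -(r : ℤ) + 1) (fun h => by obtain ⟨k, hk⟩ := h; obtain ⟨k', hk'⟩ := hrev; omega) hle'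
      simpa using this
    have h2a : Valued.v (2 * a) = exp (-((r + d - 1 : ℕ) : ℤ)) := by
      rw [Valuation.map_mul, ht, v_varpi_pow hϖ, hva, ← exp_add]
      congr 1; push_cast [Nat.cast_sub (show 1 ≤ r + d by omega)]; omega
    have hbτ : Valued.v (b * (ϖ + σ ϖ)) < exp (-((r + d - 1 : ℕ) : ℤ)) := by
      rw [Valuation.map_mul]
      calc Valued.v b * Valued.v (ϖ + σ ϖ) ≤ exp (-(r : ℤ)) * Valued.v ϖ ^ (d + 1) := by
            have hτ := v_trace_varpi_le_succ_of_odd hσ hfix hϖ hd ht hdodd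
            gcongr
        _ = exp (-(r : ℤ) + -((d + 1 : ℕ) : ℤ)) := by rw [v_varpi_pow hϖ, ← exp_add]
        _ < exp (-((r + d - 1 : ℕ) : ℤ)) := by rw [exp_lt_exp]; push_cast [Nat.cast_sub (show 1 ≤ r + d by omega)]; omega
    rw [Valuation.map_add_eq_of_lt_left _ (by rw [h2a]; exact hbτ), h2a]

end Conjuncts

/-! ## §3 From the datum predicate -/

section Datum

variable {K : Type} [Field K] [Valued K ℤᵐ⁰] {σ : K →+* K} {ϖ : K} {d t : ℕ}

/-- **`|N(1+e) − 1| ≤ |ϖ|^{r+d−1}`** from `IsRamifiedQuadraticDatum σ ϖ d t`, for `|e| ≤ |ϖ|^r`, `d ≤ r + 1`. [cite: Serre1979, Ch. V §3 Prop. 5] -/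
theorem v_norm_sub_one_le_of_isRamifiedQuadraticDatum (hD : UnitaryThreeFourFrame.IsRamifiedQuadraticDatum σ ϖ d t)
    {e : K} {r : ℕ} (hr : d ≤ r + 1) (he : Valued.v e ≤ Valued.v ϖ ^ r) :
    Valued.v (e + σ e + e * σ e) ≤ Valued.v ϖ ^ (r + d - 1) :=
  v_add_map_add_mul_map_le hD.1 hD.2.1 hD.2.2.2.1 hD.2.2.1 hD.2.2.2.2.1 hD.2.2.2.2.2.2 hD.2.2.2.2.2.1 hr he

/-- **`|N(1+e) − 1| = |ϖ|^{r+d−1}` EXACTLY** from `IsRamifiedQuadraticDatum σ ϖ d t`, for `|e| = |ϖ|^r`, `d ≤ r`, `r ≢ d (mod 2)`. [cite: Serre1979, Ch. V §3 Prop. 5] -/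
theorem v_norm_sub_one_eq_of_isRamifiedQuadraticDatum (hD : UnitaryThreeFourFrame.IsRamifiedQuadraticDatum σ ϖ d t)
    {e : K} {r : ℕ} (hr : d ≤ r) (he : Valued.v e = Valued.v ϖ ^ r) (hpar : r % 2 ≠ d % 2) :
    Valued.v (e + σ e + e * σ e) = Valued.v ϖ ^ (r + d - 1) :=
  v_add_map_add_mul_map_eq hD.1 hD.2.1 hD.2.2.2.1 hD.2.2.1 hD.2.2.2.2.1 hD.2.2.2.2.2.2 hD.2.2.2.2.2.1 hr he hpar

end Datum

end Literature.NumberTheory.LocalFields.WildQuadraticDatum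

end
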